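import Literature.NumberTheory.Automorphic.SchwartzBruhatL2UnitaryExtension
import Literature.RepresentationTheory.HeisenbergGroup.SchrodingerModel
import Literature.RepresentationTheory.HeisenbergGroup.LocalWeilProjective
import Mathlib.MeasureTheory.Group.LIntegral
import HarnessLib

/-!
# The Schrödinger representation on the Hilbert space `L²(X, ν)` and its metaplectic group of unitary pairs

Topic `RepresentationTheory/HeisenbergGroup`; namespace `Literature.RepresentationTheory.HeisenbergGroup`.  KERNEL ONLY: one
definition with body (`schrodingerL2`) and proved theorems; no named fact, no record, no `sorry`.

[MoeglinVignerasWaldspurger1987, Chap. 2 I.4 Exemple (1)] realises the Schrödinger model on the SMOOTH space `𝒮(X)`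
(the tree's `schrodingerSB β ψ`, `SchrodingerModel.lean`); [Weil1964, Chap. I n° 11–13] and [GelbartRogawski1991, §3.1
p. 454 L17–25] work with the UNITARY representation `ρ_ψ` of the Heisenberg group on a Hilbert space and the group of pairs
`(g, M_g)`, `M_g` a unitary operator with `M_g ρ_ψ(h) M_g⁻¹ = ρ_ψ(g h)`.  This file passes from the former to the latter:

* §1 (generic) **`IsL2Isometric.toUnitaryRep_apply_toUnitaryRep`**: an intertwining relation `ρ₁(a) ρ₂(b) = ρ₂(b′) ρ₁(a)`
  between two `L²`-isometric group actions on `𝒮(X)` passes to their unitary extensions on `L²(X, ν)` (density);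
* §2 **`isL2Isometric_schrodingerSB`**: the smooth Schrödinger model is `L²(ν)`-isometric for every right-invariant measure
  `ν` on `X` (`|ψ| = 1` and translation invariance of `ν`);
* §3 **`schrodingerL2 β ψ ν hd : Representation ℂ (Heisenberg (polar β)) (Lp ℂ 2 ν)`** — the unitary Schrödinger
  representation on `L²(X, ν)` (`hd` : `𝒮(X) → L²` has dense range, e.g. `SchwartzBruhat.denseRange_toLp`),
  `schrodingerL2_apply_toLp` (it extends the smooth model), `norm_schrodingerL2_apply` (unitarity),
  **`schrodingerL2_ofCenter`** (the centre acts by the character `ψ`: "central character `ψ`");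
* §4 the metaplectic group of UNITARY pairs `MpPsi (schrodingerL2 …)` ⊆ `Sp(W) × GL(L²(X, ν))`:
  **`mem_MpPsi_schrodingerL2_of_mem`** — a pair `(g, M) ∈ S̃p_ψ(W)` of the smooth model whose operator `M = ω(k)` comes
  from an `L²`-isometric group action `ω` on `𝒮(X)` yields the unitary pair `(g, U_k) ∈ MpPsi (schrodingerL2 …)`,
  `U_k` the unitary extension of `ω(k)`.

Use: `GelbartRogawski1991/LocalSplittingL2Metaplectic.lean` lands the tree's local splitting
`s_v : U(J)(F_v) → S̃p_{ψ_v}(𝕎_v)` ([GelbartRogawski1991, Prop. 3.1.1], finite places) in this unitary model.  Irreducibility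
of `schrodingerL2` (Stone–von Neumann, `StoneVonNeumann*.lean` for the `L²` system of translations/modulations) is not
re-derived here.  Nothing of the cited sources is asserted.

## References
* [MoeglinVignerasWaldspurger1987] C. Mœglin, M.-F. Vignéras, J.-L. Waldspurger, LNM 1291 (1987), Chap. 2 I.2–I.4, II.1.
* [Weil1964] A. Weil, Acta Math. 111 (1964) 143–211, Chap. I n° 11–13.
* [GelbartRogawski1991] S. Gelbart, J. Rogawski, Invent. Math. 105 (1991), §3.1 p. 454 L17–25.
-/

set_option autoImplicit false

noncomputable section

open _root_.MeasureTheory Set _root_.Filter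
open Literature.NumberTheory.Automorphic
open scoped ENNReal NNReal Topology

/-! ## §1 Intertwining relations pass to the unitary extensions -/

section Generic

variable {X : Type*} [TopologicalSpace X] [MeasurableSpace X] [OpensMeasurableSpace X] {ν : Measure X}
  [IsFiniteMeasureOnCompacts ν] {G₁ G₂ : Type*} [Group G₁] [Group G₂]
  {ρ₁ : Representation ℂ G₁ (SchwartzBruhat X)} {ρ₂ : Representation ℂ G₂ (SchwartzBruhat X)}

/-- **an intertwining relation on `𝒮(X)` passes to `L²(X, ν)`**: if `ρ₁(a) ρ₂(b) = ρ₂(b') ρ₁(a)` on Schwartz–Bruhat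
functions for two `L²`-isometric group actions, the same holds for their unitary extensions on all of `L²` (both sides
are continuous and agree on the dense subspace). [cite: Weil1964, Chap. I n° 13] -/
theorem _root_.Representation.IsL2Isometric.toUnitaryRep_apply_toUnitaryRep (h₁ : ρ₁.IsL2Isometric ν)
    (h₂ : ρ₂.IsL2Isometric ν) (hd : DenseRange (SchwartzBruhat.toLp ν : SchwartzBruhat X → Lp ℂ 2 ν))
    {a : G₁} {b b' : G₂} (hcomm : ∀ Φ : SchwartzBruhat X, ρ₁ a (ρ₂ b Φ) = ρ₂ b' (ρ₁ a Φ)) (f : Lp ℂ 2 ν) :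
    h₁.toUnitaryRep hd a (h₂.toUnitaryRep hd b f) = h₂.toUnitaryRep hd b' (h₁.toUnitaryRep hd a f) := by
  refine congrFun (hd.equalizer ((h₁.toUnitaryRep hd a).continuous.comp (h₂.toUnitaryRep hd b).continuous)
    ((h₂.toUnitaryRep hd b').continuous.comp (h₁.toUnitaryRep hd a).continuous) ?_) f
  funext Φ
  simp only [Function.comp_apply, Representation.IsL2Isometric.toUnitaryRep_apply_toLp, hcomm]

end Generic

namespace Literature.RepresentationTheory.HeisenbergGroup

variable {R : Type*} [CommRing R] {X Y : Type*} [AddCommGroup X] [Module R X] [AddCommGroup Y] [Module R Y]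
  (β : X →ₗ[R] Y →ₗ[R] R) (ψ : AddChar R Circle) [TopologicalSpace X] [TopologicalSpace R] [IsTopologicalAddGroup X]
  (hψ : IsLocallyConstant (⇑ψ : R → Circle)) (hβ : ∀ y : Y, Continuous fun u : X => β u y)
  [MeasurableSpace X] [BorelSpace X] (ν : Measure X)

/-! ## §2 The smooth Schrödinger model is `L²`-isometric -/

omit [BorelSpace X] in
/-- **the Schrödinger operators preserve the `L²(ν)` norm** for every right-invariant measure `ν` on `X`:
`|ψ(t + β(u, y)) Φ(u + x)|² = |Φ(u + x)|²` and `∫ |Φ(u + x)|² dν(u) = ∫ |Φ|² dν`.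
[cite: Weil1964, Chap. I n° 13] [cite: MoeglinVignerasWaldspurger1987, Chap. 2 I.4 Exemple (1)] -/
theorem isL2Isometric_schrodingerSB [MeasurableAdd X] [ν.IsAddRightInvariant] :
    (schrodingerSB β ψ hψ hβ).IsL2Isometric ν := by
  intro h Φ
  rw [SchwartzBruhat.l2NormSq_def, SchwartzBruhat.l2NormSq_def]
  have hpt : ∀ u : X, ‖((schrodingerSB β ψ hψ hβ h Φ : SchwartzBruhat X) : X → ℂ) u‖ₑ ^ 2 =
      ‖(Φ : X → ℂ) (u + h.v.1)‖ₑ ^ 2 := by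
    intro u
    rw [schrodingerSB_apply, enorm_mul]
    have h1 : ‖((ψ (h.t + β u h.v.2) : Circle) : ℂ)‖ₑ = 1 := by
      rw [← ofReal_norm, Circle.norm_coe, ENNReal.ofReal_one]
    rw [h1, one_mul]
  simp_rw [hpt]
  exact lintegral_add_right_eq_self (μ := ν) (fun u => ‖(Φ : X → ℂ) u‖ₑ ^ 2) h.v.1

/-! ## §3 The unitary Schrödinger representation on `L²(X, ν)` -/

section L2

variable [IsFiniteMeasureOnCompacts ν] [MeasurableAdd X] [ν.IsAddRightInvariant]
  (hd : DenseRange (SchwartzBruhat.toLp ν : SchwartzBruhat X → Lp ℂ 2 ν))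

/-- **the UNITARY SCHRÖDINGER REPRESENTATION `ρ_ψ` of the Heisenberg group `H(W)` on the Hilbert space `L²(X, ν)`**:
`h ↦` the unitary extension (`IsL2Isometric.toUnitaryRep`) of the smooth Schrödinger operator `schrodingerSB β ψ h`,
viewed as a linear endomorphism of `Lp ℂ 2 ν`. [cite: Weil1964, Chap. I n° 11–13] [cite: GelbartRogawski1991, §3.1 p. 454 L19–21] -/
def schrodingerL2 : Representation ℂ (Heisenberg (polar β)) (Lp ℂ 2 ν) where
  toFun h := (((isL2Isometric_schrodingerSB β ψ hψ hβ ν).toUnitaryRep hd h).toLinearEquiv : Lp ℂ 2 ν →ₗ[ℂ] Lp ℂ 2 ν)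
  map_one' := by
    apply LinearMap.ext
    intro f
    rw [map_one]
    rfl
  map_mul' h h' := by
    apply LinearMap.ext
    intro f
    rw [map_mul]
    rfl

/-- `schrodingerL2 h f = U_h f`, `U = toUnitaryRep` of the smooth model. [cite: Weil1964, Chap. I n° 13] -/
theorem schrodingerL2_apply (h : Heisenberg (polar β)) (f : Lp ℂ 2 ν) :
    schrodingerL2 β ψ hψ hβ ν hd h f = (isL2Isometric_schrodingerSB β ψ hψ hβ ν).toUnitaryRep hd h f := rfl

/-- **`schrodingerL2` extends the smooth model**: `ρ_ψ(h) [Φ] = [schrodingerSB h Φ]` for `Φ ∈ 𝒮(X)`.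
[cite: MoeglinVignerasWaldspurger1987, Chap. 2 I.4 Exemple (1)] -/
@[simp] theorem schrodingerL2_apply_toLp (h : Heisenberg (polar β)) (Φ : SchwartzBruhat X) :
    schrodingerL2 β ψ hψ hβ ν hd h (SchwartzBruhat.toLp ν Φ) = SchwartzBruhat.toLp ν (schrodingerSB β ψ hψ hβ h Φ) :=
  (isL2Isometric_schrodingerSB β ψ hψ hβ ν).toUnitaryRep_apply_toLp hd h Φ

/-- **unitarity**: `‖ρ_ψ(h) f‖ = ‖f‖`. [cite: GelbartRogawski1991, §3.1 p. 454 L19–21] -/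
theorem norm_schrodingerL2_apply (h : Heisenberg (polar β)) (f : Lp ℂ 2 ν) : ‖schrodingerL2 β ψ hψ hβ ν hd h f‖ = ‖f‖ :=
  (isL2Isometric_schrodingerSB β ψ hψ hβ ν).norm_toUnitaryRep_apply hd h f

/-- each `ρ_ψ(h)` is continuous on `L²`. [cite: Weil1964, Chap. I n° 13] -/
theorem continuous_schrodingerL2 (h : Heisenberg (polar β)) : Continuous (schrodingerL2 β ψ hψ hβ ν hd h) :=
  ((isL2Isometric_schrodingerSB β ψ hψ hβ ν).toUnitaryRep hd h).continuous

/-- each `ρ_ψ(h)` is surjective (a unitary operator, not merely an isometry). [cite: Weil1964, Chap. I n° 13] -/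
theorem surjective_schrodingerL2 (h : Heisenberg (polar β)) : Function.Surjective (schrodingerL2 β ψ hψ hβ ν hd h) :=
  ((isL2Isometric_schrodingerSB β ψ hψ hβ ν).toUnitaryRep hd h).surjective

/-- **central character `ψ`**: the centre `{(0, t)}` of `H(W)` acts on `L²(X, ν)` by the scalars `ψ(t)`.
[cite: GelbartRogawski1991, §3.1 p. 454 L19–21] [cite: MoeglinVignerasWaldspurger1987, Chap. 2 I.2] -/
theorem schrodingerL2_ofCenter (t : R) (f : Lp ℂ 2 ν) :
    schrodingerL2 β ψ hψ hβ ν hd (Heisenberg.ofCenter (polar β) (Multiplicative.ofAdd t)) f = ((ψ t : Circle) : ℂ) • f := by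
  refine congrFun (hd.equalizer (continuous_schrodingerL2 β ψ hψ hβ ν hd _) (continuous_const_smul ((ψ t : Circle) : ℂ)) ?_) f
  funext Φ
  simp only [Function.comp_apply, schrodingerL2_apply_toLp, schrodingerSB_ofCenter, map_smul]

/-! ## §4 The metaplectic group of unitary pairs over `L²(X, ν)` -/

/-- **from smooth pairs to unitary pairs**: let `p = (g, M) ∈ S̃p_ψ(W)` for the SMOOTH model (`MpPsi (schrodingerSB …)`:
`M schrodingerSB(h) = schrodingerSB(g·h) M`) with `M = ω(k)` an operator of an `L²(ν)`-isometric group action `ω` on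
`𝒮(X)`; then `(g, U_k) ∈ MpPsi (schrodingerL2 …)` for the unitary extension `U_k = toUnitaryRep ω k` of `ω(k)` to
`L²(X, ν)` — the relation `U_k ρ_ψ(h) U_k⁻¹ = ρ_ψ(g·h)` of [GelbartRogawski1991, §3.1 p. 454 L21–24] holds on the Hilbert
space. [cite: GelbartRogawski1991, §3.1 p. 454 L21–24] [cite: MoeglinVignerasWaldspurger1987, Chap. 2 II.1 (A)] -/
theorem mem_MpPsi_schrodingerL2_of_mem [Invertible (2 : R)] {K : Type*} [Group K] {ω : Representation ℂ K (SchwartzBruhat X)}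
    (hω : ω.IsL2Isometric ν) (k : K) {p : symplecticGroup (polar β) × (SchwartzBruhat X ≃ₗ[ℂ] SchwartzBruhat X)}
    (hp : p ∈ MpPsi (schrodingerSB β ψ hψ hβ)) (hM : ∀ Φ : SchwartzBruhat X, p.2 Φ = ω k Φ) :
    (p.1, (hω.toUnitaryRep hd k).toLinearEquiv) ∈ MpPsi (schrodingerL2 β ψ hψ hβ ν hd) := by
  rw [mem_MpPsi]
  intro h f
  have hcomm : ∀ Φ : SchwartzBruhat X, ω k (schrodingerSB β ψ hψ hβ h Φ) =
      schrodingerSB β ψ hψ hβ ((ofSymplectic (polar β) p.1).act h) (ω k Φ) := fun Φ => by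
    rw [← hM, ← hM]
    exact (mem_MpPsi _ p).1 hp h Φ
  exact hω.toUnitaryRep_apply_toUnitaryRep (isL2Isometric_schrodingerSB β ψ hψ hβ ν) hd hcomm f

end L2

end Literature.RepresentationTheory.HeisenbergGroup

end
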